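import Mathlib.Topology.ContinuousMap.Bounded.ArzelaAscoli
import Mathlib.MeasureTheory.Function.LpSpace.ContinuousFunctions
import Mathlib.Analysis.Normed.Operator.Compact.Basic
import Mathlib.Topology.ContinuousMap.Compact
import Mathlib.MeasureTheory.Function.L2Space

/-!
# T5KernelOperatorCompact — integral operators with continuous kernels on a compact space are
COMPACT on `L²` ([DE] Lemma 9.2.4 in kernel form)

Cell pub-hodge-repro2, seat p5, Tier 5 (route/T5-N4-p5.md, N4.3 v13 (B1)–(B2)).  The one input of
[DE] Theorem 9.2.2 that rows 48–53 leave prose is the COMPACTNESS of `η(f)` on `L²(Γ\G)`: [DE]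
Lemma 9.2.3 writes `η(f)` as an integral operator with the continuous kernel
`k(x, y) = Σ_γ f(x⁻¹ γ y)` on the compact `Γ\G × Γ\G`, and Lemma 9.2.4 says such operators are
compact.  This file is Lemma 9.2.4, Mathlib-only, in the following form:

* for a compact space `X`, a Hilbert space `H` and a CONTINUOUS family `K : C(X, H)`, the operator
  `evalInnerL K : H →L[ℂ] (X →ᵇ ℂ)`, `v ↦ (x ↦ ⟪K x, v⟫)`, is a **compact operator**
  (`isCompactOperator_evalInnerL`: its image of the unit ball is bounded by `‖K‖` and
  equicontinuous — `‖⟪K x₀, v⟫ − ⟪K x, v⟫‖ ≤ ‖K x₀ − K x‖ ‖v‖` — so Mathlib's Arzelà–Ascoli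
  `BoundedContinuousFunction.arzela_ascoli` applies);
* composing with Mathlib's `BoundedContinuousFunction.toLp` gives the compact operator
  `evalInnerLp μ K : H →L[ℂ] L²(X, μ)` for a finite Borel measure `μ` (`isCompactOperator_evalInnerLp`);
* for a continuous kernel `k : C(X × X, ℂ)` the family `x ↦ conj k(x, ·) ∈ L²(X, μ)` is continuous
  (`kernelFamily`), and `integralOp μ k := evalInnerLp μ (kernelFamily μ k)` is the **integral
  operator** `(T_k v)(x) = ∫ k(x, y) v(y) dμ(y)` a.e. (`coeFn_integralOp`) — **compact**
  (`isCompactOperator_integralOp`).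

What stays prose [C] after this file is [DE] Lemma 9.2.3 alone: that `η(f)` on `L²(Γ\G)` IS
`integralOp` for the kernel `Σ_γ f(x⁻¹ γ y)` (the unfolding of the Haar integral over `G` along
`Γ\G`).  Mathlib only.  Axioms: propext, Classical.choice, Quot.sound.  README §8(d): uses an
L-value-free non-vanishing device: NO.
-/

namespace Summit.Ventures.HodgeRepro2.T5KernelOperatorCompact

open MeasureTheory BoundedContinuousFunction Filter Topology
open scoped InnerProductSpace ComplexConjugate

variable {X : Type*} [TopologicalSpace X] [CompactSpace X]
variable {H : Type*} [NormedAddCommGroup H] [InnerProductSpace ℂ H]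

/-! ### The operator `v ↦ (x ↦ ⟪K x, v⟫)` of a continuous family `K : C(X, H)` -/

/-- The bounded continuous function `x ↦ ⟪K x, v⟫` of a continuous family `K : C(X, H)`. -/
noncomputable def evalInner (K : C(X, H)) (v : H) : X →ᵇ ℂ :=
  mkOfCompact ⟨fun x => ⟪K x, v⟫_ℂ, K.continuous.inner continuous_const⟩

/-- `evalInner K v` on points. -/
theorem evalInner_apply (K : C(X, H)) (v : H) (x : X) : evalInner K v x = ⟪K x, v⟫_ℂ := rfl

/-- The pointwise bound `‖⟪K x, v⟫‖ ≤ ‖K‖ ‖v‖`. -/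
theorem norm_evalInner_apply_le (K : C(X, H)) (v : H) (x : X) :
    ‖evalInner K v x‖ ≤ ‖K‖ * ‖v‖ :=
  (norm_inner_le_norm _ _).trans (mul_le_mul_of_nonneg_right (K.norm_coe_le_norm x) (norm_nonneg v))

/-- The sup-norm bound `‖evalInner K v‖ ≤ ‖K‖ ‖v‖`. -/
theorem norm_evalInner_le (K : C(X, H)) (v : H) : ‖evalInner K v‖ ≤ ‖K‖ * ‖v‖ :=
  (BoundedContinuousFunction.norm_le (by positivity)).2 fun x => norm_evalInner_apply_le K v x

/-- `evalInner K` as a linear map (`⟪K x, ·⟫` is linear in its second argument). -/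
noncomputable def evalInnerₗ (K : C(X, H)) : H →ₗ[ℂ] (X →ᵇ ℂ) where
  toFun := evalInner K
  map_add' v w := by
    ext x
    simp only [evalInner_apply, BoundedContinuousFunction.coe_add, Pi.add_apply, inner_add_right]
  map_smul' c v := by
    ext x
    simp only [evalInner_apply, BoundedContinuousFunction.coe_smul, inner_smul_right,
      RingHom.id_apply, smul_eq_mul]

/-- **`evalInner K` as a bounded operator** `H →L[ℂ] (X →ᵇ ℂ)`, `‖evalInnerL K‖ ≤ ‖K‖`. -/
noncomputable def evalInnerL (K : C(X, H)) : H →L[ℂ] (X →ᵇ ℂ) :=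
  (evalInnerₗ K).mkContinuous ‖K‖ fun v => norm_evalInner_le K v

/-- `evalInnerL K` on points. -/
theorem evalInnerL_apply (K : C(X, H)) (v : H) (x : X) : evalInnerL K v x = ⟪K x, v⟫_ℂ := rfl

/-- **Arzelà–Ascoli: `evalInnerL K` is a compact operator.** The image of the unit ball is bounded
by `‖K‖` and equicontinuous (`‖⟪K x₀, v⟫ − ⟪K x, v⟫‖ ≤ ‖K x₀ − K x‖ ‖v‖`). -/
theorem isCompactOperator_evalInnerL (K : C(X, H)) : IsCompactOperator (evalInnerL K) := by
  refine (isCompactOperator_iff_isCompact_closure_image_ball (evalInnerL K : H →ₗ[ℂ] (X →ᵇ ℂ))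
    zero_lt_one).2 ?_
  refine BoundedContinuousFunction.arzela_ascoli (Metric.closedBall (0 : ℂ) ‖K‖)
    (isCompact_closedBall _ _) _ ?_ ?_
  · -- uniform bound
    rintro f x ⟨v, hv, rfl⟩
    rw [Metric.mem_closedBall, dist_zero_right]
    calc ‖(evalInnerL K : H →ₗ[ℂ] (X →ᵇ ℂ)) v x‖ ≤ ‖K‖ * ‖v‖ := norm_evalInner_apply_le K v x
      _ ≤ ‖K‖ * 1 := mul_le_mul_of_nonneg_left (le_of_lt (mem_ball_zero_iff.1 hv)) (norm_nonneg K)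
      _ = ‖K‖ := mul_one _
  · -- equicontinuity
    intro x₀
    rw [Metric.equicontinuousAt_iff_right]
    intro ε hε
    have hK : ∀ᶠ x in 𝓝 x₀, dist (K x) (K x₀) < ε :=
      Metric.tendsto_nhds.1 (K.continuous.tendsto x₀) ε hε
    filter_upwards [hK] with x hx
    rintro ⟨f, v, hv, rfl⟩
    calc dist ((evalInnerL K : H →ₗ[ℂ] (X →ᵇ ℂ)) v x₀) ((evalInnerL K : H →ₗ[ℂ] (X →ᵇ ℂ)) v x)
        = ‖⟪K x₀ - K x, v⟫_ℂ‖ := by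
          rw [dist_eq_norm, inner_sub_left]
          rfl
      _ ≤ ‖K x₀ - K x‖ * ‖v‖ := norm_inner_le_norm _ _
      _ ≤ ‖K x₀ - K x‖ * 1 :=
          mul_le_mul_of_nonneg_left (le_of_lt (mem_ball_zero_iff.1 hv)) (norm_nonneg _)
      _ = dist (K x) (K x₀) := by rw [mul_one, dist_comm, dist_eq_norm]
      _ < ε := hx

/-! ### Into `L²(X, μ)` -/

variable [MeasurableSpace X] [BorelSpace X] (μ : Measure X) [IsFiniteMeasure μ]

/-- The operator `v ↦ (x ↦ ⟪K x, v⟫)` into `L²(X, μ)` — `toLp ∘ evalInnerL K`. -/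
noncomputable def evalInnerLp (K : C(X, H)) : H →L[ℂ] Lp ℂ 2 μ :=
  (BoundedContinuousFunction.toLp (E := ℂ) 2 μ ℂ).comp (evalInnerL K)

/-- `evalInnerLp μ K v` is a.e. the function `x ↦ ⟪K x, v⟫`. -/
theorem coeFn_evalInnerLp (K : C(X, H)) (v : H) :
    (evalInnerLp μ K v : X → ℂ) =ᵐ[μ] fun x => ⟪K x, v⟫_ℂ :=
  BoundedContinuousFunction.coeFn_toLp 2 μ ℂ (evalInner K v)

/-- **`evalInnerLp μ K` is a compact operator** (a compact operator followed by the continuous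
linear map `toLp`). -/
theorem isCompactOperator_evalInnerLp (K : C(X, H)) : IsCompactOperator (evalInnerLp μ K) :=
  (isCompactOperator_evalInnerL K).clm_comp (BoundedContinuousFunction.toLp (E := ℂ) 2 μ ℂ)

/-! ### Integral operators with continuous kernels -/

/-- The conjugate kernel `(x, y) ↦ conj k(x, y)`. -/
noncomputable def conjKernel (k : C(X × X, ℂ)) : C(X × X, ℂ) :=
  ⟨fun p => conj (k p), Complex.continuous_conj.comp k.continuous⟩

/-- The continuous family `x ↦ conj k(x, ·) ∈ L²(X, μ)` attached to a continuous kernel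
`k : C(X × X, ℂ)` (continuity: `curry` of a continuous map, the isometry `C(X, ℂ) ≃ᵢ (X →ᵇ ℂ)`
and the continuous linear map `toLp`). -/
noncomputable def kernelFamily (k : C(X × X, ℂ)) : C(X, Lp ℂ 2 μ) where
  toFun x :=
    BoundedContinuousFunction.toLp (E := ℂ) 2 μ ℂ (mkOfCompact ((conjKernel k).curry x))
  continuous_toFun := by
    have h1 : Continuous fun x => mkOfCompact ((conjKernel k).curry x) :=
      (ContinuousMap.isometryEquivBoundedOfCompact X ℂ).continuous.comp
        (conjKernel k).curry.continuous
    exact (BoundedContinuousFunction.toLp (E := ℂ) 2 μ ℂ).continuous.comp h1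

/-- `kernelFamily μ k x` is a.e. the function `y ↦ conj k(x, y)`. -/
theorem coeFn_kernelFamily (k : C(X × X, ℂ)) (x : X) :
    (kernelFamily μ k x : X → ℂ) =ᵐ[μ] fun y => conj (k (x, y)) :=
  BoundedContinuousFunction.coeFn_toLp 2 μ ℂ (mkOfCompact ((conjKernel k).curry x))

/-- **The integral operator** `(T_k v)(x) = ∫ k(x, y) v(y) dμ(y)` of a continuous kernel on
`L²(X, μ)`. -/
noncomputable def integralOp (k : C(X × X, ℂ)) : Lp ℂ 2 μ →L[ℂ] Lp ℂ 2 μ :=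
  evalInnerLp μ (kernelFamily μ k)

/-- `integralOp μ k v` is a.e. the integral `x ↦ ∫ k(x, y) v(y) dμ(y)`. -/
theorem coeFn_integralOp (k : C(X × X, ℂ)) (v : Lp ℂ 2 μ) :
    (integralOp μ k v : X → ℂ) =ᵐ[μ] fun x => ∫ y, k (x, y) * v y ∂μ := by
  refine (coeFn_evalInnerLp μ (kernelFamily μ k) v).trans (Eventually.of_forall fun x => ?_)
  show ⟪kernelFamily μ k x, v⟫_ℂ = ∫ y, k (x, y) * v y ∂μ
  rw [L2.inner_def]
  refine integral_congr_ae ?_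
  filter_upwards [coeFn_kernelFamily μ k x] with y hy
  rw [hy, RCLike.inner_apply, Complex.conj_conj, mul_comm]

/-- **[DE] Lemma 9.2.4 in kernel form: integral operators with continuous kernels on a compact
space with a finite Borel measure are COMPACT on `L²`.** -/
theorem isCompactOperator_integralOp (k : C(X × X, ℂ)) : IsCompactOperator (integralOp μ k) :=
  isCompactOperator_evalInnerLp μ (kernelFamily μ k)

end Summit.Ventures.HodgeRepro2.T5KernelOperatorCompact
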